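import Mathlib
import Summits.Ventures.FusionMHD.Models.CerfonFreidbergIterLikeQ25Defs
import HarnessLib

/-!
# Ventures/FusionMHD — Models/CerfonFreidbergIterLikeQ25Panels8.lean: KERNEL CHECK of panels 27, 28, 29 (of 32) of the
# certified safety factor `q(ψ_N = 1/4)/F` of THE Cerfon–Freidberg ITER-like instance (sibling of `…IterLikeQHalfPanels*.lean`)

HONEST FRAMING (LADDER-GRIDFUSION three columns; CF rung, F2 item R2, q-profile sample).  One `decide +kernel` (≈ 92 s on the farm): for
each panel `j` listed, the per-panel obligation `CFIterLike.Q25.PanelCert.ok` (`Models/CerfonFreidbergIterLikeQ25Defs.lean`) — the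
Taylor-model run of `CFIterLike.Q25.progG` over the ITER-like parameter box is ACCEPTED (every `log`/`sin`/`cos` composition and the `inv`
certificate), and the kernel's panel-integral enclosure of the polar `(6.35)` integrand along the approximant, the range of the flux residual
`U(ray m) − 3U_a/4`, the range of the approximant `m` and the range of the radial derivative `D_r(θ, m)` lie inside the integers claimed in
`panelCert8` (values read off a compiled `#eval` of the same functions, slack one unit of `2⁻⁶⁰`; probe `QProbeIF*.lean`, generator
`pub/gridfusion/models/gen-model-5/g8/gen90/mkdefsN.py`).  What these Booleans MEAN (real-number statements, uniformly over the parameter box ∋ THE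
ITER-like instance) is proved once in `Models/CerfonFreidbergIterLikeQ25Sound.lean`.  MODELLED: analytic Cerfon–Freidberg family; `q` of a
MODEL surface — nothing about a device or stability.  No `native_decide`.  Typer/prover: gridfusion-model-5 (g8), 2026-08-27.
Citations: Freidberg 2014 §6.3.5 (6.35) [Freidberg2014]; Mahboubi–Melquiond–Sibut-Pinote 2016 §3.2 Lemma 3 [MahboubiMelquiondSibutpinote2016].
-/

namespace Summit.Ventures.FusionMHD.Models.CFIterLike.Q25

/-- The certificate data of panels 27, 28, 29 (`ψ_N = 1/4`): `inv` candidate (degree-12 fit of `(X·D_r)⁻¹` in the panel variable, scaled by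
`2⁶⁰`), Taylor degree, `inv` widening `2^elog2`, and the claimed integral / residual / `m`-range / `D_r`-range integers (× `2⁶⁰`). [instance data] -/
def panelCert8 : List PanelCert := [
  { j := 27, cand := [13690599474352826368, -13596706619397111808, 51748857416551833600, -10633788859852337152, -130966503751225638912, 958435961419734450176, -3329587916981148844032, 8739206363318162817024, -14582233732747016273920, 53440102961581276528640, -3625577366916993170538496, -61171228311246521122160640, 5545166148816095740671557632],
    deg := 8, elog2 := 38, plo := 237912717642913165, phi := 237912729187306428, eta := 319246960, mlo := 200728941382390972, mhi := 207146888767349326,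
    dlo := 107685939906474429, dhi := 111595239579548399 },
  { j := 28, cand := [13315814672782049280, -10405515507305117696, 50234501433467371520, -19410182869533024256, -21640003834726522880, 488140975911973552128, -1813942614267803992064, 5266379029937793269760, -25031401625606875512832, -106164716389654507552768, 42874422314378659306143744, 186151441437859646621614080, -53448679067309256010297769984],
    deg := 10, elog2 := 37, plo := 225349556155471036, phi := 225349561764565379, eta := 166618541, mlo := 196129625084799387, mhi := 201095947367650482,
    dlo := 111417610569598993, dhi := 114621024321260584 },
  { j := 29, cand := [13039099453055666176, -7323332068460549120, 48413978551592763392, -18300243946786629632, 32892819760888659968, 236670218979868016640, -954075599418575814656, 2799809435650307915776, -10239364642702526251008, 124435700000249356484608, 11958577400799307300339712, -169693890024529112785223680, -18151803713923287982320648192],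
    deg := 12, elog2 := 37, plo := 216301247300574104, phi := 216301252738560967, eta := 160991431, mlo := 192900677775695372, mhi := 196480239278146672,
    dlo := 114422388644214225, dhi := 116834074594540028 }]

/-- **KERNEL CHECK** of panels 27, 28, 29 of the ITER-like surface `ψ_N = 1/4`. -/
theorem panelCert8_ok : CFIterLike.Q25.panelCert8.all PanelCert.ok = true := by
  decide +kernel

end Summit.Ventures.FusionMHD.Models.CFIterLike.Q25
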